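import Summits.QuantumFields.YangMills.Theorems.UnitScaleTiltProp7CovariantCoercivity
import Literature.MathematicalPhysics.QuantumFieldTheory.Balaban1983to89.B11Eq135Weitzenbock
import HarnessLib

/-!
# Route `UnitScaleTilt`, crux K1 child «MinimiserStabilityRegPr» (stmt-QuantumFields-19200), registered stub `stub_prop7From14` (v4 828f5fb4a904d3be;
# leaf V3 «Prop 7 from a background (14)» = `T3Thm1CarrierNative.Prop7From14At`) — sub-lemma V3-D1b at a NON-FLAT background, part 1/3: THE REAL TRACE
# PAIRING `Re Tr X^*Y` ON `M_N(ℂ)` (the `L²` scalar product of [Balaban1985BackgroundPropagators] p. 392 «X·Y = tr XY», unnormalised, real part),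
# ITS HILBERT–SCHMIDT SIZE `Σ_{jk}|X_jk|²`, UNITARY CONJUGATION, AND THE CURVATURE PAIRING ESTIMATE

Cell `ym3-torus` ∕ fleet seat `ym-ust-19200-p1` (HUMAN RULING D-0037, YM ladder rung R3), successor g2.  WHERE THIS SITS.  The quadratic form of
[Balaban1985BackgroundPropagators] Thm 3.11 is `⟨A, (Δ₁ + DRD^* + aQ^*Q)A⟩`; its curl–divergence part `⟨A, (D^*D_U + DD^*)A⟩` is compared with the gradient
form `⟨A, Δ_U A⟩ = Σ‖D_{U,ν}A_μ‖²` by the lattice Weitzenböck identity (135) of [Balaban1985Variational] — PROVED in the tree as an OPERATOR identity at every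
background (`B11Eq135Weitzenbock.eq135_torus`: `D^*D_U + DD^* = Δ_U − 𝒦`).  The sequels (`UnitScaleTiltProp7CovariantWeitzenbock`, `UnitScaleTiltProp7SmallFieldThm311`)
PAIR it with `A` for UNITARY backgrounds (the tree's adjointness (3.8)/(3.9) `B9Eq39Adjoint.sum_covD_mul` ∕ `sum_curl_mul` with the tracial functional
`Re Tr`, and `(R(u)X)^* = R(u)X^*` for unitary `u`) and bound the curvature pairing `⟨A, 𝒦A⟩` by `2da·Σ‖A‖²_HS` when the plaquette variables are within `a`
of `1`.  This file supplies the `M_N(ℂ)` algebra.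

WHAT IS PROVED (sorry-free, no definition; [folklore] ∕ cited to the printed object): `Re Tr(X^*Y)` in components and its symmetry; `Re Tr(X^*X) = Σ_{jk}|X_jk|²`
(tree `MatrixNorms.sum_norm_sq_eq_re_trace`); the weighted AM–GM `2|Re Tr(X^*K)| ≤ sΣ|X_jk|² + s⁻¹Σ|K_jk|²`; `Σ|(X+Y)_jk|² ≤ 2Σ|X_jk|² + 2Σ|Y_jk|²`; the one-sided
operator-norm bounds `Σ|(XY)_jk|² ≤ ‖X‖²Σ|Y_jk|²`, `Σ|(YX)_jk|² ≤ Σ|Y_jk|²‖X‖²` (tree `MatrixNorms.nhsNormSq_mul_le`, `nhsNorm_mul_le_nhsNorm_mul_opNorm`) and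
`Σ|X_jk|² ≤ N‖X‖²`; for a unitary unit `u`: `u⁻¹ = u^*`, **`(R(u)X)^* = R(u)X^*`** (`R` = `B9Eq39Adjoint.R`, `R(u)X = uXu⁻¹`), `Σ|(R(u)X)_jk|² = Σ|X_jk|²`; and
**`abs_re_trace_curv_le`**: `|Re Tr(X^*·R(t)(R(W)Z − Z))| ≤ a·(Σ|X_jk|² + Σ|Z_jk|²)` for unitary `t`, `W` with `‖W − 1‖ ≤ a` — the estimate applied to each
summand of the curvature operator `𝒦` of (135).

References: T. Bałaban, CMP 99 (1985) 389–434 [Balaban1985BackgroundPropagators] ((3.8)–(3.10) p.392, Thm 3.11 p.416); CMP 102 (1985) 277–309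
[Balaban1985Variational] ((135) p.298); CMP 98 (1985) 17–51 [Balaban1985Averaging] ((17) p.20).
-/

noncomputable section

open scoped BigOperators Matrix.Norms.L2Operator Matrix

namespace Summit.QuantumFields.YangMills.Theorems.Prop7CovariantCoercivity

open Literature.MathematicalPhysics.QuantumFieldTheory.Balaban1983to89
open Finset B1RG242Torus
open B7Prop1Explicit (plaqWord U1)
open B7Eq78Linearization (conjR conjR_apply)
open B9Eq39Adjoint (R R_def covD covDstar curl divB divP plaqU curl_self curl_swap sum_covD_mul sum_sum_covD_mul sum_curl_mul trace_R)
open B11Eq135Weitzenbock (vecLap curvOp hodgeOp transp plaqU' eq135_torus vecLap_def curvOp_def hodgeOp_def norm_plaqU'_sub_one_le)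
open B9TorusCalculus (torusT torusT_apply torusT_symm_apply torusT_comm)

variable {N : ℕ} [NeZero N]

/-! ## §1 The real trace pairing `Re Tr X^*Y` on `M_N(ℂ)` and the Hilbert–Schmidt size `Σ_{jk}|X_{jk}|²` -/

section Pairing

omit [NeZero N] in
/-- `Re Tr(X^*Y) = Σ_{jk} (Re X_jk Re Y_jk + Im X_jk Im Y_jk)` — the real Hilbert–Schmidt pairing in components. [cite: Balaban1985Averaging, (17) p.20] -/
theorem re_trace_conjTranspose_mul (X Y : Matrix (Fin N) (Fin N) ℂ) :
    ((Xᴴ * Y).trace).re = ∑ j : Fin N, ∑ k : Fin N, ((X j k).re * (Y j k).re + (X j k).im * (Y j k).im) := by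
  simp only [Matrix.trace, Matrix.diag_apply, Matrix.mul_apply, Matrix.conjTranspose_apply, Complex.star_def, Complex.re_sum,
    Complex.mul_re, Complex.conj_re, Complex.conj_im]
  rw [Finset.sum_comm]
  refine Finset.sum_congr rfl fun j _ => Finset.sum_congr rfl fun k _ => ?_
  ring

omit [NeZero N] in
/-- `Re Tr(X^*X) = Σ_{jk}|X_jk|²`. [cite: Balaban1985Averaging, (17) p.20] -/
theorem re_trace_conjTranspose_mul_self (X : Matrix (Fin N) (Fin N) ℂ) :
    ((Xᴴ * X).trace).re = ∑ j : Fin N, ∑ k : Fin N, ‖X j k‖ ^ 2 :=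
  (MatrixNorms.sum_norm_sq_eq_re_trace X).symm

omit [NeZero N] in
/-- The pairing is symmetric: `Re Tr(X^*Y) = Re Tr(Y^*X)`. [folklore] -/
theorem re_trace_conjTranspose_mul_comm (X Y : Matrix (Fin N) (Fin N) ℂ) :
    ((Xᴴ * Y).trace).re = ((Yᴴ * X).trace).re := by
  rw [re_trace_conjTranspose_mul, re_trace_conjTranspose_mul]
  refine Finset.sum_congr rfl fun j _ => Finset.sum_congr rfl fun k _ => ?_
  ring

omit [NeZero N] in
/-- Weighted Cauchy–Schwarz ∕ AM–GM for the pairing: `2|Re Tr(X^*K)| ≤ s·Σ|X_jk|² + s⁻¹·Σ|K_jk|²` for `s > 0`. [folklore] -/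
theorem two_mul_abs_re_trace_le {s : ℝ} (hs : 0 < s) (X K : Matrix (Fin N) (Fin N) ℂ) :
    2 * |((Xᴴ * K).trace).re| ≤ s * ∑ j : Fin N, ∑ k : Fin N, ‖X j k‖ ^ 2 + s⁻¹ * ∑ j : Fin N, ∑ k : Fin N, ‖K j k‖ ^ 2 := by
  rw [re_trace_conjTranspose_mul, Finset.mul_sum, Finset.mul_sum, ← Finset.sum_add_distrib]
  have key : ∀ j, 2 * |∑ k : Fin N, ((X j k).re * (K j k).re + (X j k).im * (K j k).im)|
      ≤ s * ∑ k : Fin N, ‖X j k‖ ^ 2 + s⁻¹ * ∑ k : Fin N, ‖K j k‖ ^ 2 := by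
    intro j
    rw [Finset.mul_sum, Finset.mul_sum, ← Finset.sum_add_distrib]
    have hk : ∀ k, 2 * |(X j k).re * (K j k).re + (X j k).im * (K j k).im| ≤ s * ‖X j k‖ ^ 2 + s⁻¹ * ‖K j k‖ ^ 2 := by
      intro k
      rw [Complex.sq_norm, Complex.sq_norm, Complex.normSq_apply, Complex.normSq_apply]
      have hss : s * s⁻¹ = 1 := mul_inv_cancel₀ hs.ne'
      have e1 : 0 ≤ s * ((X j k).re - s⁻¹ * (K j k).re) ^ 2 + s * ((X j k).im - s⁻¹ * (K j k).im) ^ 2 := by positivity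
      have e2 : 0 ≤ s * ((X j k).re + s⁻¹ * (K j k).re) ^ 2 + s * ((X j k).im + s⁻¹ * (K j k).im) ^ 2 := by positivity
      have x1 : s * ((X j k).re - s⁻¹ * (K j k).re) ^ 2 + s * ((X j k).im - s⁻¹ * (K j k).im) ^ 2
          = s * ((X j k).re * (X j k).re + (X j k).im * (X j k).im) - 2 * ((X j k).re * (K j k).re + (X j k).im * (K j k).im) * (s * s⁻¹)
            + s⁻¹ * ((K j k).re * (K j k).re + (K j k).im * (K j k).im) * (s * s⁻¹) := by ring
      have x2 : s * ((X j k).re + s⁻¹ * (K j k).re) ^ 2 + s * ((X j k).im + s⁻¹ * (K j k).im) ^ 2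
          = s * ((X j k).re * (X j k).re + (X j k).im * (X j k).im) + 2 * ((X j k).re * (K j k).re + (X j k).im * (K j k).im) * (s * s⁻¹)
            + s⁻¹ * ((K j k).re * (K j k).re + (K j k).im * (K j k).im) * (s * s⁻¹) := by ring
      rw [hss, mul_one, mul_one] at x1 x2
      rcases abs_cases ((X j k).re * (K j k).re + (X j k).im * (K j k).im) with ⟨h, _⟩ | ⟨h, _⟩ <;> rw [h] <;> linarith
    calc 2 * |∑ k : Fin N, ((X j k).re * (K j k).re + (X j k).im * (K j k).im)|
        ≤ 2 * ∑ k : Fin N, |(X j k).re * (K j k).re + (X j k).im * (K j k).im| :=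
          mul_le_mul_of_nonneg_left (Finset.abs_sum_le_sum_abs _ _) zero_le_two
      _ = ∑ k : Fin N, 2 * |(X j k).re * (K j k).re + (X j k).im * (K j k).im| := by rw [Finset.mul_sum]
      _ ≤ _ := Finset.sum_le_sum fun k _ => hk k
  calc 2 * |∑ j : Fin N, ∑ k : Fin N, ((X j k).re * (K j k).re + (X j k).im * (K j k).im)|
      ≤ 2 * ∑ j : Fin N, |∑ k : Fin N, ((X j k).re * (K j k).re + (X j k).im * (K j k).im)| :=
        mul_le_mul_of_nonneg_left (Finset.abs_sum_le_sum_abs _ _) zero_le_two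
    _ = ∑ j : Fin N, 2 * |∑ k : Fin N, ((X j k).re * (K j k).re + (X j k).im * (K j k).im)| := by rw [Finset.mul_sum]
    _ ≤ _ := Finset.sum_le_sum fun j _ => key j

omit [NeZero N] in
/-- `Σ_{jk}|(X + Y)_jk|² ≤ 2Σ|X_jk|² + 2Σ|Y_jk|²`. [folklore] -/
theorem sum_norm_sq_add_le (X Y : Matrix (Fin N) (Fin N) ℂ) :
    ∑ j : Fin N, ∑ k : Fin N, ‖(X + Y) j k‖ ^ 2 ≤ 2 * ∑ j : Fin N, ∑ k : Fin N, ‖X j k‖ ^ 2 + 2 * ∑ j : Fin N, ∑ k : Fin N, ‖Y j k‖ ^ 2 := by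
  rw [Finset.mul_sum, Finset.mul_sum, ← Finset.sum_add_distrib]
  refine Finset.sum_le_sum fun j _ => ?_
  rw [Finset.mul_sum, Finset.mul_sum, ← Finset.sum_add_distrib]
  refine Finset.sum_le_sum fun k _ => ?_
  rw [Matrix.add_apply]
  have h1 := pow_le_pow_left₀ (norm_nonneg _) (norm_add_le (X j k) (Y j k)) 2
  nlinarith [h1, sq_nonneg (‖X j k‖ - ‖Y j k‖)]

omit [NeZero N] in
/-- `Σ_{jk}|(XY)_jk|² ≤ ‖X‖²·Σ|Y_jk|²` (operator norm acting on the left; tree `MatrixNorms.nhsNormSq_mul_le`). [folklore] -/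
theorem sum_norm_sq_mul_le (X Y : Matrix (Fin N) (Fin N) ℂ) :
    ∑ j : Fin N, ∑ k : Fin N, ‖(X * Y) j k‖ ^ 2 ≤ ‖X‖ ^ 2 * ∑ j : Fin N, ∑ k : Fin N, ‖Y j k‖ ^ 2 := by
  rcases isEmpty_or_nonempty (Fin N) with hN | hN
  · simp
  have h := MatrixNorms.nhsNormSq_mul_le X Y
  have hc : (0 : ℝ) < Fintype.card (Fin N) := by exact_mod_cast Fintype.card_pos
  have e1 := MatrixNorms.card_mul_nhsNormSq (X * Y)
  have e2 := MatrixNorms.card_mul_nhsNormSq Y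
  rw [← e1, ← e2]
  nlinarith [mul_le_mul_of_nonneg_left h hc.le]

omit [NeZero N] in
/-- `Σ_{jk}|(YX)_jk|² ≤ Σ|Y_jk|²·‖X‖²` (operator norm acting on the right; tree `MatrixNorms.nhsNorm_mul_le_nhsNorm_mul_opNorm`). [folklore] -/
theorem sum_norm_sq_mul_le' (Y X : Matrix (Fin N) (Fin N) ℂ) :
    ∑ j : Fin N, ∑ k : Fin N, ‖(Y * X) j k‖ ^ 2 ≤ (∑ j : Fin N, ∑ k : Fin N, ‖Y j k‖ ^ 2) * ‖X‖ ^ 2 := by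
  rcases isEmpty_or_nonempty (Fin N) with hN | hN
  · simp
  have h := MatrixNorms.nhsNorm_mul_le_nhsNorm_mul_opNorm Y X
  have h0 : 0 ≤ MatrixNorms.nhsNorm (Y * X) := MatrixNorms.nhsNorm_nonneg _
  have h2 : MatrixNorms.nhsNormSq (Y * X) ≤ MatrixNorms.nhsNormSq Y * ‖X‖ ^ 2 := by
    rw [← MatrixNorms.nhsNorm_sq, ← MatrixNorms.nhsNorm_sq]
    have := mul_le_mul h h h0 (mul_nonneg (MatrixNorms.nhsNorm_nonneg _) (norm_nonneg _))
    nlinarith [this]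
  have hc : (0 : ℝ) < Fintype.card (Fin N) := by exact_mod_cast Fintype.card_pos
  rw [← MatrixNorms.card_mul_nhsNormSq (Y * X), ← MatrixNorms.card_mul_nhsNormSq Y]
  nlinarith [mul_le_mul_of_nonneg_left h2 hc.le]

omit [NeZero N] in
/-- The pairing against the operator norm: `Σ_{jk}|X_jk|² ≤ N‖X‖²`. [folklore] -/
theorem sum_norm_sq_le_mul_opNorm_sq (X : Matrix (Fin N) (Fin N) ℂ) :
    ∑ j : Fin N, ∑ k : Fin N, ‖X j k‖ ^ 2 ≤ N * ‖X‖ ^ 2 := by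
  rw [Finset.sum_comm]
  calc ∑ k : Fin N, ∑ j : Fin N, ‖X j k‖ ^ 2 ≤ ∑ _k : Fin N, ‖X‖ ^ 2 :=
        Finset.sum_le_sum fun k _ => MatrixNorms.sum_norm_sq_col_le_opNorm_sq X k
    _ = N * ‖X‖ ^ 2 := by simp

/-! ### Unitary conjugation and the adjoint -/

omit [NeZero N] in
/-- For a unitary unit `u` of `M_N(ℂ)`: `u⁻¹ = u^*`. [folklore] -/
theorem coe_inv_eq_star {u : (Matrix (Fin N) (Fin N) ℂ)ˣ} (hu : (u : Matrix (Fin N) (Fin N) ℂ) ∈ unitary (Matrix (Fin N) (Fin N) ℂ)) :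
    ((u⁻¹ : (Matrix (Fin N) (Fin N) ℂ)ˣ) : Matrix (Fin N) (Fin N) ℂ) = star (u : Matrix (Fin N) (Fin N) ℂ) := by
  have h := Unitary.star_mul_self_of_mem hu
  calc ((u⁻¹ : (Matrix (Fin N) (Fin N) ℂ)ˣ) : Matrix (Fin N) (Fin N) ℂ)
      = star (u : Matrix (Fin N) (Fin N) ℂ) * ((u : Matrix (Fin N) (Fin N) ℂ) * ((u⁻¹ : (Matrix (Fin N) (Fin N) ℂ)ˣ) : Matrix (Fin N) (Fin N) ℂ)) := by
        rw [← mul_assoc, h, one_mul]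
    _ = star (u : Matrix (Fin N) (Fin N) ℂ) := by rw [Units.mul_inv, mul_one]

omit [NeZero N] in
/-- **`R(u)` commutes with the adjoint for unitary `u`**: `(uXu⁻¹)^* = uX^*u⁻¹`. [folklore] -/
theorem conjTranspose_R {u : (Matrix (Fin N) (Fin N) ℂ)ˣ} (hu : (u : Matrix (Fin N) (Fin N) ℂ) ∈ unitary (Matrix (Fin N) (Fin N) ℂ))
    (X : Matrix (Fin N) (Fin N) ℂ) : (R u X)ᴴ = R u Xᴴ := by
  rw [R_def, R_def, coe_inv_eq_star hu, Matrix.star_eq_conjTranspose, Matrix.conjTranspose_mul, Matrix.conjTranspose_mul,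
    Matrix.conjTranspose_conjTranspose, mul_assoc]

omit [NeZero N] in
/-- `R(u)` preserves `Σ|X_jk|²` for unitary `u` (`Re Tr((uXu⁻¹)^*(uXu⁻¹)) = Re Tr(u X^*X u⁻¹) = Re Tr X^*X`). [folklore] -/
theorem sum_norm_sq_R {u : (Matrix (Fin N) (Fin N) ℂ)ˣ} (hu : (u : Matrix (Fin N) (Fin N) ℂ) ∈ unitary (Matrix (Fin N) (Fin N) ℂ))
    (X : Matrix (Fin N) (Fin N) ℂ) :
    ∑ j : Fin N, ∑ k : Fin N, ‖(R u X) j k‖ ^ 2 = ∑ j : Fin N, ∑ k : Fin N, ‖X j k‖ ^ 2 := by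
  rw [← re_trace_conjTranspose_mul_self, ← re_trace_conjTranspose_mul_self, conjTranspose_R hu, B9Eq39Adjoint.R_mul_R]
  have := trace_R (Complex.reAddGroupHom.comp (Matrix.traceAddMonoidHom (Fin N) ℂ))
    (fun a b => by simp [Matrix.trace_mul_comm a b]) u (Xᴴ * X)
  simpa using this

/-- **THE CURVATURE PAIRING ESTIMATE**: for unitary `t`, `W` with `‖W − 1‖ ≤ a` and all `X`, `Z`:
`|Re Tr(X^* · R(t)(R(W)Z − Z))| ≤ a·(Σ|X_jk|² + Σ|Z_jk|²)` (`R(W)Z − Z = (W−1)ZW⁻¹ + Z(W⁻¹−1)`, `‖W⁻¹ − 1‖ = ‖W − 1‖`, weighted AM–GM).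
[cite: Balaban1985Variational, (135) p.298] -/
theorem abs_re_trace_curv_le {t W : (Matrix (Fin N) (Fin N) ℂ)ˣ} (ht : (t : Matrix (Fin N) (Fin N) ℂ) ∈ unitary (Matrix (Fin N) (Fin N) ℂ))
    (hW : (W : Matrix (Fin N) (Fin N) ℂ) ∈ unitary (Matrix (Fin N) (Fin N) ℂ)) {a : ℝ} (ha : ‖(W : Matrix (Fin N) (Fin N) ℂ) - 1‖ ≤ a)
    (X Z : Matrix (Fin N) (Fin N) ℂ) :
    |((Xᴴ * R t (R W Z - Z)).trace).re| ≤ a * (∑ j : Fin N, ∑ k : Fin N, ‖X j k‖ ^ 2 + ∑ j : Fin N, ∑ k : Fin N, ‖Z j k‖ ^ 2) := by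
  letI : CStarAlgebra (Matrix (Fin N) (Fin N) ℂ) := B10Eq29TubeLine.cstarAlgebraMatrix N
  have ha0 : 0 ≤ a := (norm_nonneg _).trans ha
  -- the size of `K = R(t)(R(W)Z − Z)`
  have hWinv : ‖((W⁻¹ : (Matrix (Fin N) (Fin N) ℂ)ˣ) : Matrix (Fin N) (Fin N) ℂ) - 1‖ ≤ a := by
    have hW1 : W ∈ U1 (Matrix (Fin N) (Fin N) ℂ) := B7Prop2Explicit.unitaryUnits_le_U1 (B7Prop2Explicit.mem_unitaryUnits.mpr hW)
    exact (B7Prop1Explicit.norm_inv_sub_one_le hW1).trans ha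
  have hWn : ‖((W⁻¹ : (Matrix (Fin N) (Fin N) ℂ)ˣ) : Matrix (Fin N) (Fin N) ℂ)‖ ≤ 1 :=
    (B7Prop2Explicit.unitaryUnits_le_U1 (B7Prop2Explicit.mem_unitaryUnits.mpr hW)).2
  have hK : ∑ j : Fin N, ∑ k : Fin N, ‖(R t (R W Z - Z)) j k‖ ^ 2 ≤ 4 * a ^ 2 * ∑ j : Fin N, ∑ k : Fin N, ‖Z j k‖ ^ 2 := by
    rw [sum_norm_sq_R ht]
    have hdec : R W Z - Z = ((W : Matrix (Fin N) (Fin N) ℂ) - 1) * Z * ((W⁻¹ : (Matrix (Fin N) (Fin N) ℂ)ˣ) : Matrix (Fin N) (Fin N) ℂ)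
        + Z * (((W⁻¹ : (Matrix (Fin N) (Fin N) ℂ)ˣ) : Matrix (Fin N) (Fin N) ℂ) - 1) := by
      rw [R_def]; noncomm_ring
    rw [hdec]
    have h1 : ∑ j : Fin N, ∑ k : Fin N, ‖(((W : Matrix (Fin N) (Fin N) ℂ) - 1) * Z * ((W⁻¹ : (Matrix (Fin N) (Fin N) ℂ)ˣ) : Matrix (Fin N) (Fin N) ℂ)) j k‖ ^ 2
        ≤ a ^ 2 * ∑ j : Fin N, ∑ k : Fin N, ‖Z j k‖ ^ 2 := by
      have s1 := sum_norm_sq_mul_le' (((W : Matrix (Fin N) (Fin N) ℂ) - 1) * Z) ((W⁻¹ : (Matrix (Fin N) (Fin N) ℂ)ˣ) : Matrix (Fin N) (Fin N) ℂ)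
      have s2 := sum_norm_sq_mul_le ((W : Matrix (Fin N) (Fin N) ℂ) - 1) Z
      have hZ0 : 0 ≤ ∑ j : Fin N, ∑ k : Fin N, ‖Z j k‖ ^ 2 := Finset.sum_nonneg fun _ _ => Finset.sum_nonneg fun _ _ => sq_nonneg _
      have hS0 : 0 ≤ ∑ j : Fin N, ∑ k : Fin N, ‖(((W : Matrix (Fin N) (Fin N) ℂ) - 1) * Z) j k‖ ^ 2 :=
        Finset.sum_nonneg fun _ _ => Finset.sum_nonneg fun _ _ => sq_nonneg _
      have hn2 : ‖((W⁻¹ : (Matrix (Fin N) (Fin N) ℂ)ˣ) : Matrix (Fin N) (Fin N) ℂ)‖ ^ 2 ≤ 1 := by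
        have := hWn; have h0 := norm_nonneg ((W⁻¹ : (Matrix (Fin N) (Fin N) ℂ)ˣ) : Matrix (Fin N) (Fin N) ℂ); nlinarith
      have ha2 : ‖(W : Matrix (Fin N) (Fin N) ℂ) - 1‖ ^ 2 ≤ a ^ 2 := pow_le_pow_left₀ (norm_nonneg _) ha 2
      calc _ ≤ (∑ j : Fin N, ∑ k : Fin N, ‖(((W : Matrix (Fin N) (Fin N) ℂ) - 1) * Z) j k‖ ^ 2) * ‖((W⁻¹ : (Matrix (Fin N) (Fin N) ℂ)ˣ) : Matrix (Fin N) (Fin N) ℂ)‖ ^ 2 := s1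
        _ ≤ (∑ j : Fin N, ∑ k : Fin N, ‖(((W : Matrix (Fin N) (Fin N) ℂ) - 1) * Z) j k‖ ^ 2) * 1 := mul_le_mul_of_nonneg_left hn2 hS0
        _ ≤ ‖(W : Matrix (Fin N) (Fin N) ℂ) - 1‖ ^ 2 * ∑ j : Fin N, ∑ k : Fin N, ‖Z j k‖ ^ 2 := by rw [mul_one]; exact s2
        _ ≤ a ^ 2 * ∑ j : Fin N, ∑ k : Fin N, ‖Z j k‖ ^ 2 := mul_le_mul_of_nonneg_right ha2 hZ0
    have h2 : ∑ j : Fin N, ∑ k : Fin N, ‖(Z * (((W⁻¹ : (Matrix (Fin N) (Fin N) ℂ)ˣ) : Matrix (Fin N) (Fin N) ℂ) - 1)) j k‖ ^ 2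
        ≤ a ^ 2 * ∑ j : Fin N, ∑ k : Fin N, ‖Z j k‖ ^ 2 := by
      have s1 := sum_norm_sq_mul_le' Z (((W⁻¹ : (Matrix (Fin N) (Fin N) ℂ)ˣ) : Matrix (Fin N) (Fin N) ℂ) - 1)
      have hZ0 : 0 ≤ ∑ j : Fin N, ∑ k : Fin N, ‖Z j k‖ ^ 2 := Finset.sum_nonneg fun _ _ => Finset.sum_nonneg fun _ _ => sq_nonneg _
      have ha2 : ‖((W⁻¹ : (Matrix (Fin N) (Fin N) ℂ)ˣ) : Matrix (Fin N) (Fin N) ℂ) - 1‖ ^ 2 ≤ a ^ 2 := pow_le_pow_left₀ (norm_nonneg _) hWinv 2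
      calc _ ≤ (∑ j : Fin N, ∑ k : Fin N, ‖Z j k‖ ^ 2) * ‖((W⁻¹ : (Matrix (Fin N) (Fin N) ℂ)ˣ) : Matrix (Fin N) (Fin N) ℂ) - 1‖ ^ 2 := s1
        _ ≤ (∑ j : Fin N, ∑ k : Fin N, ‖Z j k‖ ^ 2) * a ^ 2 := mul_le_mul_of_nonneg_left ha2 hZ0
        _ = _ := mul_comm _ _
    have h3 := sum_norm_sq_add_le (((W : Matrix (Fin N) (Fin N) ℂ) - 1) * Z * ((W⁻¹ : (Matrix (Fin N) (Fin N) ℂ)ˣ) : Matrix (Fin N) (Fin N) ℂ))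
      (Z * (((W⁻¹ : (Matrix (Fin N) (Fin N) ℂ)ˣ) : Matrix (Fin N) (Fin N) ℂ) - 1))
    linarith [h1, h2, h3]
  -- weighted AM–GM with `s = 2a` (or `K = 0` when `a = 0`)
  have hX0 : 0 ≤ ∑ j : Fin N, ∑ k : Fin N, ‖X j k‖ ^ 2 := Finset.sum_nonneg fun _ _ => Finset.sum_nonneg fun _ _ => sq_nonneg _
  have hZ0 : 0 ≤ ∑ j : Fin N, ∑ k : Fin N, ‖Z j k‖ ^ 2 := Finset.sum_nonneg fun _ _ => Finset.sum_nonneg fun _ _ => sq_nonneg _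
  rcases eq_or_lt_of_le ha0 with h0 | hpos
  · -- `a = 0`: the curvature term vanishes
    subst h0
    have hK0 : ∑ j : Fin N, ∑ k : Fin N, ‖(R t (R W Z - Z)) j k‖ ^ 2 = 0 :=
      le_antisymm (hK.trans (by simp)) (Finset.sum_nonneg fun _ _ => Finset.sum_nonneg fun _ _ => sq_nonneg _)
    have hKz : R t (R W Z - Z) = 0 := by
      ext j k
      have hj := (Finset.sum_eq_zero_iff_of_nonneg fun j _ => Finset.sum_nonneg fun k _ => sq_nonneg _).mp hK0 j (Finset.mem_univ j)
      have hjk := (Finset.sum_eq_zero_iff_of_nonneg fun k _ => sq_nonneg _).mp hj k (Finset.mem_univ k)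
      have := pow_eq_zero_iff (n := 2) (by norm_num) |>.mp hjk
      simpa using this
    rw [hKz, mul_zero, Matrix.trace_zero, Complex.zero_re, abs_zero, zero_mul]
  · have h := two_mul_abs_re_trace_le (s := 2 * a) (by positivity) X (R t (R W Z - Z))
    have h2 : (2 * a)⁻¹ * ∑ j : Fin N, ∑ k : Fin N, ‖(R t (R W Z - Z)) j k‖ ^ 2 ≤ 2 * a * ∑ j : Fin N, ∑ k : Fin N, ‖Z j k‖ ^ 2 := by
      rw [inv_mul_le_iff₀ (by positivity)]
      nlinarith [hK]
    nlinarith [h, h2, abs_nonneg ((Xᴴ * R t (R W Z - Z)).trace).re]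

end Pairing

end Summit.QuantumFields.YangMills.Theorems.Prop7CovariantCoercivity

end
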